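import Literature.MathematicalPhysics.QuantumLattice.LatticeGaugeDLRFreeEnergyProofs
import HarnessLib

/-!
# Plaquette lattice gauge theory with a general continuous positive weight:
# box decomposition of the torus partition function

For a compact second-countable group `G`, a dimension `d` and a *general* single-plaquette
weight `v : G → ℝ` (continuous, and pinched `e^{-K} ≤ v ≤ e^{K}` where bounds are needed — which
is automatic for a continuous positive `v` on the compact `G`, `exists_exp_neg_le_le_exp`), the
pure plaquette theory on the discrete torus `(ℤ/Lℤ)^d` has the partition function
`Z_L(v) = ∫ ∏_{q} v(U_q) ∏_{e} dHaar(U_e)` (all plaquettes `q`, `U_q` the plaquette holonomy,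
product Haar probability measure over the positively oriented edges). This file is the
weight-dependent half of a line-by-line port of `LatticeGaugeDLRFreeEnergyProofs` (the Wilson
weight `v = exp(-β (N - Re tr ρ))`) to such `v`, following Friedli–Velenik, proof of Thm. 3.6:

* (`dependsOn_boxWeight`, `boxWeight_comp_edgeShift`, `zdZ_image_shift`, `zdZ_union`,
  `zdZ_biUnion_translate`) the free-boundary partition functions
  `Z(A) = ∫ ∏_{p ∈ A} v(U_p) dg_∞` of finite sets `A` of plaquettes of `ℤ^d`, against the
  infinite product Haar measure `dg_∞ = QuantumFieldTheory.zdHaar`, are translation invariant and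
  factorise over edge-disjoint sets, so that `Z(⋃_{a ∈ [0,q)^d} (A_m + m a)) = Z(A_m)^{q^d}` for
  the box of plaquettes `A_m = [0, m-1)^d × {planes}`;
* (`torusWeight_univ_le`, `mul_torusWeight_le_univ`, `integral_torusWeight_image`) on the torus,
  discarding the plaquettes outside the image of `⋃_a (A_m + m a)` (`q = ⌊L/m⌋`) costs a factor
  `e^{±K}` each, and the remaining integral is transferred to `ℤ^d` by the periodisation lemma
  `QuantumFieldTheory.integral_torusLift_eq_integral_zdHaar`;
* (`abs_log_torusZ_sub_le`) hence the sub-box estimate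
  `|log Z_L(v) − q^d log Z(A_m)| ≤ K · #planes · (L^d − q^d (m−1)^d)`.

The thermodynamic limit itself is concluded in the sequel file `PlaquetteWeightFreeEnergyLimit`
(`tendsto_torusPressure_of_continuous_pos`). The weight-independent geometry
(`FreeEnergy.mem_boxPlaqs`, `shift_injective`, `disjoint_image_shift`,
`disjoint_biUnion_plaquetteEdges`, `toTorus_injOn`, `injOn_torusEdge_biUnion`,
`card_image_toTorus`, …) is reused from `LatticeGaugeDLRFreeEnergyProofs`; as there, the weights
and partition functions are *local notations* for explicit expressions (no definition is
introduced), and the lemmas live in the sub-namespace `PlaquetteWeightFreeEnergy`.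
Nothing uses `d ≥ 2` or any structure of `v` beyond continuity and the two-sided bound.

## References

* S. Friedli, Y. Velenik, *Statistical Mechanics of Lattice Systems*, CUP 2017, Ch. 3, §3.2.2,
  Thm. 3.6 and its proof (decomposition into translates of a fixed box; any boundary
  condition). [FriedliVelenik2017]
* E. Seiler, LNP 159 (1982), Ch. 2 (thermodynamic functions of lattice gauge theories).
  [SeilerLNP1982]
-/

noncomputable section

open MeasureTheory Filter Topology Finset
open Literature.Probability.LatticeModels

namespace Literature.MathematicalPhysics.QuantumLattice

namespace PlaquetteWeightFreeEnergy

open FreeEnergy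

variable {d : ℕ}

/-- The box of plaquettes of side `n`: base point in `[0, n)^d`, any plane (local notation
`𝔅⟦n⟧` for `halfOpenBox d n ×ˢ univ`, as in `LatticeGaugeDLRFreeEnergyProofs`). [folklore] -/
local notation3 (prettyPrint := false) "𝔅⟦" n "⟧" =>
  (halfOpenBox d n ×ˢ Finset.univ : Finset (ZdPlaquette d))

/-- Translation of plaquettes by `a ∈ ℤ^d` (local notation `𝔰⟦a⟧`). [folklore] -/
local notation3 (prettyPrint := false) "𝔰⟦" a "⟧" =>
  fun p : ZdPlaquette d => (p.1 + a, p.2)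

/-- The torus plaquette below a plaquette of `ℤ^d` (local notation `𝔭⟦L⟧`). [folklore] -/
local notation3 (prettyPrint := false) "𝔭⟦" L "⟧" =>
  fun p : ZdPlaquette d => ((Torus.proj L p.1, p.2) : QuantumFieldTheory.Plaquette d L)

/-! ### A continuous positive function on a compact space is pinched between `e^{-K}`, `e^{K}` -/

/-- On a compact space a continuous positive function satisfies `e^{-K} ≤ f ≤ e^{K}` for some `K`
(`K = sup |log f|`). [folklore] -/
theorem exists_exp_neg_le_le_exp {X : Type*} [TopologicalSpace X] [CompactSpace X] {f : X → ℝ}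
    (hf : Continuous f) (hpos : ∀ x, 0 < f x) :
    ∃ K : ℝ, ∀ x, Real.exp (-K) ≤ f x ∧ f x ≤ Real.exp K := by
  obtain ⟨K, hK⟩ := isCompact_univ.exists_bound_of_continuousOn
    (hf.log fun x => (hpos x).ne').continuousOn
  refine ⟨K, fun x => ?_⟩
  have h : |Real.log (f x)| ≤ K := by
    simpa only [Real.norm_eq_abs] using hK x (Set.mem_univ x)
  constructor
  · calc Real.exp (-K) ≤ Real.exp (Real.log (f x)) := Real.exp_le_exp.2 (abs_le.1 h).1
      _ = f x := Real.exp_log (hpos x)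
  · calc f x = Real.exp (Real.log (f x)) := (Real.exp_log (hpos x)).symm
      _ ≤ Real.exp K := Real.exp_le_exp.2 (abs_le.1 h).2

/-! ### Weights and partition functions (local notations)

From here on the single-plaquette weight `v : G → ℝ` is fixed. The weight of a plaquette `p` of
`ℤ^d` in the configuration `U` is `𝔴⟦p, U⟧ = v(U_p)`; the free-boundary partition function of a
finite set `A` of plaquettes is `ℨ⟦A⟧ = ∫ ∏_{p ∈ A} 𝔴⟦p, U⟧ dg_∞(U)` against the infinite product
Haar measure `QuantumFieldTheory.zdHaar`; on the discrete torus the weight of a plaquette is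
`𝔱⟦p, U⟧ = v(U_p)` with Wave 0's `plaquetteHolonomy`. -/

variable {G : Type*} [Group G] (v : G → ℝ)

/-- The weight `v(U_p)` of one plaquette of `ℤ^d` (local notation). [folklore] -/
local notation3 (prettyPrint := false) "𝔴⟦" p ", " U "⟧" =>
  v (plaquetteHolonomyZd U (Prod.fst p) (Prod.snd p).1.1 (Prod.snd p).1.2)

/-- The free-boundary partition function `Z(A) = ∫ ∏_{p ∈ A} v(U_p) dg_∞` of a finite set of
plaquettes of `ℤ^d` (local notation). [folklore] -/
local notation3 (prettyPrint := false) "ℨ⟦" A "⟧" =>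
  ∫ U, ∏ p ∈ A, 𝔴⟦p, U⟧ ∂QuantumFieldTheory.zdHaar d G

/-- The weight `v(U_p)` of one plaquette of the discrete torus (local notation). [folklore] -/
local notation3 (prettyPrint := false) "𝔱⟦" p ", " U "⟧" =>
  v (QuantumFieldTheory.plaquetteHolonomy U (Prod.fst p) (Prod.snd p).1.1 (Prod.snd p).1.2)

/-! ### Pointwise bounds, locality and covariance of the weights -/

/-- `(e^{-K})^{|A|} ≤ ∏_{p ∈ A} v(U_p)` when `e^{-K} ≤ v`. [folklore] -/
theorem pow_le_boxWeight {K : ℝ} (hK : ∀ g, Real.exp (-K) ≤ v g ∧ v g ≤ Real.exp K)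
    (A : Finset (ZdPlaquette d)) (U : LGConfig d G) :
    Real.exp (-K) ^ #A ≤ ∏ p ∈ A, 𝔴⟦p, U⟧ := by
  rw [← prod_const]
  exact prod_le_prod (fun p _ => (Real.exp_pos _).le) fun p _ => (hK _).1

/-- The weight of a plaquette depends only on its four edges. [folklore] -/
theorem dependsOn_plaquetteWeight (p : ZdPlaquette d) :
    DependsOn (fun U : LGConfig d G => 𝔴⟦p, U⟧) (plaquetteEdges p : Set (ZdEdge d)) := by
  intro U V h
  simp only [plaquetteHolonomyZd]
  rw [h (p.1, p.2.1.1) (by simp [plaquetteEdges]),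
    h (p.1 + Pi.single p.2.1.1 1, p.2.1.2) (by simp [plaquetteEdges]),
    h (p.1 + Pi.single p.2.1.2 1, p.2.1.1) (by simp [plaquetteEdges]),
    h (p.1, p.2.1.2) (by simp [plaquetteEdges])]

/-- The box weight depends only on the edges of its plaquettes. [folklore] -/
theorem dependsOn_boxWeight (A : Finset (ZdPlaquette d)) :
    DependsOn (fun U : LGConfig d G => ∏ p ∈ A, 𝔴⟦p, U⟧) ↑(A.biUnion plaquetteEdges) :=
  QuantumFieldTheory.AreaLaw.dependsOn_finset_prod A plaquetteEdges _ fun p _ =>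
    dependsOn_plaquetteWeight v p

/-- Translating the configuration translates the plaquettes:
`W_A(U ∘ θ_a) = W_{A + a}(U)`. [folklore] -/
theorem boxWeight_comp_edgeShift (a : Site d) (A : Finset (ZdPlaquette d)) (U : LGConfig d G) :
    ∏ p ∈ A, 𝔴⟦p, (fun e => U (edgeShift a e))⟧ = ∏ p ∈ A.image 𝔰⟦a⟧, 𝔴⟦p, U⟧ := by
  rw [prod_image fun p _ q _ h => shift_injective a h]
  refine prod_congr rfl fun p _ => ?_
  simp only [plaquetteHolonomyZd, edgeShift_apply, add_right_comm _ _ a]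

/-- Dropping the torus plaquettes outside `I` costs at most a factor `e^K` per plaquette
(upper bound). [folklore] -/
theorem torusWeight_univ_le {K : ℝ} (hK : ∀ g, Real.exp (-K) ≤ v g ∧ v g ≤ Real.exp K)
    {L : ℕ} [NeZero L] (I : Finset (QuantumFieldTheory.Plaquette d L))
    (U : QuantumFieldTheory.GaugeConfig d L G) :
    ∏ p : QuantumFieldTheory.Plaquette d L, 𝔱⟦p, U⟧ ≤ Real.exp K ^ #Iᶜ * ∏ p ∈ I, 𝔱⟦p, U⟧ := by
  classical
  rw [← prod_mul_prod_compl I, mul_comm]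
  refine mul_le_mul_of_nonneg_right ?_
    (prod_nonneg fun p _ => (Real.exp_pos _).le.trans (hK _).1)
  rw [← prod_const]
  exact prod_le_prod (fun p _ => (Real.exp_pos _).le.trans (hK _).1) fun p _ => (hK _).2

/-- Dropping the torus plaquettes outside `I` costs at most a factor `e^K` per plaquette
(lower bound). [folklore] -/
theorem mul_torusWeight_le_univ {K : ℝ} (hK : ∀ g, Real.exp (-K) ≤ v g ∧ v g ≤ Real.exp K)
    {L : ℕ} [NeZero L] (I : Finset (QuantumFieldTheory.Plaquette d L))
    (U : QuantumFieldTheory.GaugeConfig d L G) :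
    Real.exp (-K) ^ #Iᶜ * ∏ p ∈ I, 𝔱⟦p, U⟧ ≤ ∏ p : QuantumFieldTheory.Plaquette d L, 𝔱⟦p, U⟧ := by
  classical
  rw [← prod_mul_prod_compl I, mul_comm]
  refine mul_le_mul_of_nonneg_left ?_
    (prod_nonneg fun p _ => (Real.exp_pos _).le.trans (hK _).1)
  rw [← prod_const]
  exact prod_le_prod (fun p _ => (Real.exp_pos _).le) fun p _ => (hK _).1

/-- The torus weight of the image of a set `I'` of plaquettes of `ℤ^d` based in `[0, L-2]^d` is
the `ℤ^d` box weight of `I'` read on the periodic lift. [folklore] -/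
theorem torusWeight_image_eq {L : ℕ} [NeZero L] {I' : Finset (ZdPlaquette d)}
    (hI' : ∀ p ∈ I', ∀ k, 0 ≤ p.1 k ∧ p.1 k + 2 ≤ L) (U : QuantumFieldTheory.GaugeConfig d L G) :
    ∏ p ∈ I'.image 𝔭⟦L⟧, 𝔱⟦p, U⟧ = ∏ p ∈ I', 𝔴⟦p, (torusLift L U)⟧ := by
  classical
  rw [prod_image (toTorus_injOn hI')]
  refine prod_congr rfl fun p _ => ?_
  simp only [plaquetteHolonomyZd_torusLift]

/-! ### Continuity -/

variable [TopologicalSpace G] [IsTopologicalGroup G]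

/-- The box weight is continuous for continuous `v`. [folklore] -/
theorem continuous_boxWeight (hv : Continuous v) (A : Finset (ZdPlaquette d)) :
    Continuous fun U : LGConfig d G => ∏ p ∈ A, 𝔴⟦p, U⟧ := by
  refine continuous_finsetProd _ fun p _ => hv.comp ?_
  unfold plaquetteHolonomyZd
  fun_prop

/-- The torus weights are continuous for continuous `v`. [folklore] -/
theorem continuous_torusWeight (hv : Continuous v) {L : ℕ} [NeZero L]
    (I : Finset (QuantumFieldTheory.Plaquette d L)) :
    Continuous fun U : QuantumFieldTheory.GaugeConfig d L G => ∏ p ∈ I, 𝔱⟦p, U⟧ := by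
  refine continuous_finsetProd _ fun p _ => hv.comp ?_
  unfold QuantumFieldTheory.plaquetteHolonomy
  fun_prop

/-! ### The free-boundary partition functions on `ℤ^d` -/

variable [CompactSpace G] [MeasurableSpace G] [BorelSpace G] [SecondCountableTopology G]

/-- The box weight is integrable for `dg_∞`. [folklore] -/
theorem integrable_boxWeight (hv : Continuous v) (A : Finset (ZdPlaquette d)) :
    Integrable (fun U : LGConfig d G => ∏ p ∈ A, 𝔴⟦p, U⟧) (QuantumFieldTheory.zdHaar d G) :=
  QuantumFieldTheory.AreaLaw.integrable_zdHaar_of_continuous (continuous_boxWeight v hv A)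

/-- `(e^{-K})^{|A|} ≤ Z(A)`. [folklore] -/
theorem pow_le_zdZ (hv : Continuous v) {K : ℝ}
    (hK : ∀ g, Real.exp (-K) ≤ v g ∧ v g ≤ Real.exp K) (A : Finset (ZdPlaquette d)) :
    Real.exp (-K) ^ #A ≤ ℨ⟦A⟧ := by
  calc Real.exp (-K) ^ #A = ∫ _U, Real.exp (-K) ^ #A ∂QuantumFieldTheory.zdHaar d G := by simp
    _ ≤ ℨ⟦A⟧ :=
        integral_mono (integrable_const _) (integrable_boxWeight v hv A)
          fun U => pow_le_boxWeight v hK A U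

/-- The free-boundary partition functions are positive. [folklore] -/
theorem zdZ_pos (hv : Continuous v) {K : ℝ} (hK : ∀ g, Real.exp (-K) ≤ v g ∧ v g ≤ Real.exp K)
    (A : Finset (ZdPlaquette d)) : 0 < ℨ⟦A⟧ :=
  lt_of_lt_of_le (pow_pos (Real.exp_pos _) _) (pow_le_zdZ v hv hK A)

/-- **Translation invariance** of the free-boundary partition functions: `Z(A + a) = Z(A)`
(`dg_∞` is invariant under the edge shift). [folklore] -/
theorem zdZ_image_shift (hv : Continuous v) (a : Site d) (A : Finset (ZdPlaquette d)) :
    ℨ⟦A.image 𝔰⟦a⟧⟧ = ℨ⟦A⟧ := by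
  calc ℨ⟦A.image 𝔰⟦a⟧⟧
      = ∫ U, ∏ p ∈ A, 𝔴⟦p, (fun e => U (edgeShift a e))⟧ ∂QuantumFieldTheory.zdHaar d G := by
        simp_rw [boxWeight_comp_edgeShift]
    _ = ℨ⟦A⟧ :=
        integral_comp_reindex_infinitePi (QuantumFieldTheory.haarProbability G) (edgeShift a)
          (integrable_boxWeight v hv A).aestronglyMeasurable

/-- **Factorisation** of the free-boundary partition functions over edge-disjoint sets of
plaquettes: `Z(A ∪ B) = Z(A) Z(B)`. [folklore] -/
theorem zdZ_union (hv : Continuous v) {A B : Finset (ZdPlaquette d)} (hAB : Disjoint A B)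
    (hE : Disjoint (A.biUnion plaquetteEdges) (B.biUnion plaquetteEdges)) :
    ℨ⟦(A ∪ B)⟧ = ℨ⟦A⟧ * ℨ⟦B⟧ := by
  simp_rw [prod_union hAB]
  exact QuantumFieldTheory.AreaLaw.integral_zdHaar_mul_eq_of_dependsOn hE
    (dependsOn_boxWeight v A) (dependsOn_boxWeight v B)
    (continuous_boxWeight v hv A).measurable (continuous_boxWeight v hv B).measurable

/-- The partition function of a disjoint union of translates (by multiples of `m ≥ n + 1`) of
the box of side `n` is the `|V|`-th power of the box partition function. [folklore] -/
theorem zdZ_biUnion_translate (hv : Continuous v) {n m : ℕ} (hm : n + 1 ≤ m)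
    (V : Finset (Site d)) :
    ℨ⟦(V.biUnion fun a => 𝔅⟦n⟧.image 𝔰⟦(m : ℤ) • a⟧)⟧ = ℨ⟦𝔅⟦n⟧⟧ ^ #V := by
  classical
  induction V using Finset.induction_on with
  | empty => simp
  | insert a V ha ih =>
    rw [biUnion_insert, zdZ_union v hv, ih, zdZ_image_shift v hv, card_insert_of_notMem ha,
      pow_succ']
    · rw [Finset.disjoint_biUnion_right]
      intro w hw
      exact disjoint_image_shift hm fun h => ha (h ▸ hw)
    · rw [Finset.biUnion_biUnion, Finset.disjoint_biUnion_right]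
      intro w hw
      exact disjoint_biUnion_plaquetteEdges hm fun h => ha (h ▸ hw)

/-! ### The torus side -/

/-- The torus weights are integrable for the product Haar measure. [folklore] -/
theorem integrable_torusWeight (hv : Continuous v) {L : ℕ} [NeZero L]
    (I : Finset (QuantumFieldTheory.Plaquette d L)) :
    Integrable (fun U : QuantumFieldTheory.GaugeConfig d L G => ∏ p ∈ I, 𝔱⟦p, U⟧)
      (Measure.pi fun _ : QuantumFieldTheory.Edge d L => QuantumFieldTheory.haarProbability G) :=
  (continuous_torusWeight v hv I).integrable_of_hasCompactSupport
    (HasCompactSupport.of_compactSpace _)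

/-- **Transfer to `ℤ^d`.** The product-Haar integral of the torus weight of the image of a set
`I'` of plaquettes of `ℤ^d` based in `[0, L-2]^d` is the free-boundary partition function
`Z(I')` (periodisation, `QuantumFieldTheory.integral_torusLift_eq_integral_zdHaar`). [folklore] -/
theorem integral_torusWeight_image (hv : Continuous v) {L : ℕ} [NeZero L]
    {I' : Finset (ZdPlaquette d)} (hI' : ∀ p ∈ I', ∀ k, 0 ≤ p.1 k ∧ p.1 k + 2 ≤ L) :
    ∫ U, ∏ p ∈ I'.image 𝔭⟦L⟧, 𝔱⟦p, U⟧
        ∂(Measure.pi fun _ : QuantumFieldTheory.Edge d L => QuantumFieldTheory.haarProbability G) =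
      ℨ⟦I'⟧ := by
  simp_rw [torusWeight_image_eq v hI']
  exact QuantumFieldTheory.integral_torusLift_eq_integral_zdHaar (injOn_torusEdge_biUnion hI')
    (continuous_boxWeight v hv I').measurable (dependsOn_boxWeight v I')

/-! ### The sub-box estimate -/

/-- **The sub-box estimate** (Friedli–Velenik 2017, proof of Thm. 3.6, for the plaquette
interaction with a general weight and the periodic boundary condition). With `q = ⌊L/m⌋` and the
box of plaquettes `A_m = [0, m-1)^d × {planes}`,
`|log Z_L(v) - q^d log Z(A_m)| ≤ K · #planes · (L^d - q^d (m-1)^d)` whenever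
`e^{-K} ≤ v ≤ e^{K}`: keep the plaquettes of the `q^d` translates `A_m + m a`, `a ∈ [0, q)^d`
(edges inside pairwise disjoint cubes, base points in `[0, L-2]^d`), at a cost `e^{±K}` per
discarded plaquette; the remaining integral factorises into `q^d` copies of `Z(A_m)`
(periodisation, factorisation, translation invariance). [cite: FriedliVelenik2017, Ch. 3 §3.2.2, proof of Thm. 3.6 (decomposition into translates of a fixed box; periodic boundary condition)] -/
theorem abs_log_torusZ_sub_le (hv : Continuous v) {K : ℝ}
    (hK : ∀ g, Real.exp (-K) ≤ v g ∧ v g ≤ Real.exp K) (L m : ℕ) [NeZero L] (hm : 1 ≤ m) :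
    |Real.log (∫ U, ∏ p : QuantumFieldTheory.Plaquette d L, 𝔱⟦p, U⟧
        ∂(Measure.pi fun _ : QuantumFieldTheory.Edge d L => QuantumFieldTheory.haarProbability G)) -
        ((L / m) ^ d : ℕ) * Real.log ℨ⟦𝔅⟦m - 1⟧⟧| ≤
      K * (Fintype.card {q : Fin d × Fin d // q.1 < q.2} *
        ((L : ℝ) ^ d - ((L / m) ^ d : ℕ) * ((m - 1 : ℕ) : ℝ) ^ d)) := by
  classical
  set q : ℕ := L / m with hq
  set D : ℕ := Fintype.card {q : Fin d × Fin d // q.1 < q.2} with hD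
  set A : Finset (ZdPlaquette d) := 𝔅⟦m - 1⟧ with hA
  set V : Finset (Site d) := halfOpenBox d q with hV
  set I' : Finset (ZdPlaquette d) := V.biUnion fun a => A.image 𝔰⟦(m : ℤ) • a⟧ with hI'
  set I : Finset (QuantumFieldTheory.Plaquette d L) := I'.image 𝔭⟦L⟧ with hI
  set P : Measure (QuantumFieldTheory.GaugeConfig d L G) :=
    Measure.pi fun _ => QuantumFieldTheory.haarProbability G with hP
  have hm' : m - 1 + 1 ≤ m := by omega
  -- the plaquettes kept are based in `[0, L - 2]^d`
  have hI'b : ∀ p ∈ I', ∀ k, 0 ≤ p.1 k ∧ p.1 k + 2 ≤ L := by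
    intro p hp k
    obtain ⟨a, ha, hpa⟩ := mem_biUnion.1 hp
    obtain ⟨ha0, haq⟩ := mem_halfOpenBox.1 ha k
    obtain ⟨h1, h2⟩ := fst_bounds_of_mem_image_shift hpa k
    simp only [Pi.smul_apply, smul_eq_mul] at h1 h2
    have hm1 : ((m - 1 : ℕ) : ℤ) = m - 1 := by push_cast [Nat.cast_sub hm]; ring
    have hqm : (m : ℤ) * q ≤ L := by exact_mod_cast Nat.mul_div_le L m
    have hma : 0 ≤ (m : ℤ) * a k := mul_nonneg (by positivity) ha0
    have hma' : (m : ℤ) * (a k + 1) ≤ m * q :=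
      mul_le_mul_of_nonneg_left (by linarith) (by positivity)
    rw [hm1] at h2
    constructor
    · linarith
    · nlinarith
  -- cardinalities
  have hcardI : #I = q ^ d * #A := by
    rw [hI, card_image_toTorus hI'b, hI', card_biUnion]
    · simp_rw [card_image_of_injective _ (shift_injective _)]
      rw [sum_const, hV, card_halfOpenBox, smul_eq_mul]
    · intro a _ b _ hab
      exact disjoint_image_shift hm' hab
  have hcardA : #A = (m - 1) ^ d * D := card_boxPlaqs _
  have hcard_univ : Fintype.card (QuantumFieldTheory.Plaquette d L) = L ^ d * D := by
    rw [hD, Fintype.card_prod, Fintype.card_fun, ZMod.card, Fintype.card_fin]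
  have hcompl : (#Iᶜ : ℝ) = (L : ℝ) ^ d * D - (q : ℝ) ^ d * ((m - 1 : ℕ) : ℝ) ^ d * D := by
    rw [card_compl, Nat.cast_sub (card_le_univ I), hcard_univ, hcardI, hcardA]
    push_cast
    ring
  -- the integrals
  set T : ℝ := ∫ U, ∏ p : QuantumFieldTheory.Plaquette d L, 𝔱⟦p, U⟧ ∂P with hT
  set z : ℝ := ℨ⟦A⟧ with hz
  have hz0 : 0 < z := zdZ_pos v hv hK A
  have hZI : ∫ U, ∏ p ∈ I, 𝔱⟦p, U⟧ ∂P = z ^ (q ^ d) := by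
    rw [hI, hP, integral_torusWeight_image v hv hI'b, hI', zdZ_biUnion_translate v hv hm' V, hV,
      card_halfOpenBox]
  have hup : T ≤ Real.exp K ^ #Iᶜ * z ^ (q ^ d) := by
    rw [← hZI, ← integral_const_mul]
    exact integral_mono (integrable_torusWeight v hv _)
      ((integrable_torusWeight v hv I).const_mul _) fun U => torusWeight_univ_le v hK I U
  have hlow : Real.exp (-K) ^ #Iᶜ * z ^ (q ^ d) ≤ T := by
    rw [← hZI, ← integral_const_mul]
    exact integral_mono ((integrable_torusWeight v hv I).const_mul _)
      (integrable_torusWeight v hv _) fun U => mul_torusWeight_le_univ v hK I U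
  have hT0 : 0 < T := lt_of_lt_of_le (by positivity) hlow
  -- logarithms
  have h1 : Real.log T ≤ #Iᶜ * K + (q ^ d : ℕ) * Real.log z := by
    have := Real.log_le_log hT0 hup
    rwa [Real.log_mul (by positivity) (by positivity), Real.log_pow, Real.log_exp,
      Real.log_pow] at this
  have h2 : #Iᶜ * (-K) + (q ^ d : ℕ) * Real.log z ≤ Real.log T := by
    have := Real.log_le_log (by positivity) hlow
    rwa [Real.log_mul (by positivity) (by positivity), Real.log_pow, Real.log_exp,
      Real.log_pow] at this
  rw [abs_le]
  have hKD : (#Iᶜ : ℝ) * K = K * (D * ((L : ℝ) ^ d - (q ^ d : ℕ) * ((m - 1 : ℕ) : ℝ) ^ d)) := by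
    rw [hcompl]; push_cast; ring
  constructor <;> nlinarith [hKD, h1, h2]

end PlaquetteWeightFreeEnergy

end Literature.MathematicalPhysics.QuantumLattice
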